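import Summits.CriticalPhenomena.PercolationContinuityZ3.Theorems.PercNearOneGluingNoHeavyLowerTailKnQuestion8CoefficientwiseCoreClassKernelMixBundleWithUnitThreadCount
import Summits.CriticalPhenomena.PercolationContinuityZ3.Theorems.PercNearOneGluingNoHeavyLowerTailKnQuestion8CoefficientwiseCoreClassKernelMixIETLayerCake
import HarnessLib

/-!
# ★ CONJECTURE IET on every bundle with a unit thread `Θ(ℓ₀, …, ℓ_{r−2}, 1)`: all monotone real levels, every up-closed event

Support file (`--supports stmt-CriticalPhenomena-4575`, closed), prover `prim-cplus-coupling` (gen 67).  No definitions, no notations, no named facts, no sorries;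
standard axioms.  Memos `prim-cplus-coupling/A5-COUPLING-gen61.md` §3.2, `A5-COUPLING-gen66.md` §1–3 (two-type theorem), `A5-COUPLING-gen67.md` §1 (L5 link).

THEOREM `Coefficientwise.iet_bundle_withUnitThread`: on an explicit bundle with hubs `u, b` and ANY number `r` of internally disjoint `u–b` threads of ARBITRARY lengths,
one of which is the edge `u b` itself (a chorded bundle `Θ(ℓ₀, …, ℓ_{r−2}, 1)`), the IET functional
  `Σ_{ω ∈ 𝒱, b ∈ X∖Y} h(X) k(X) + Σ_{ω ∈ 𝒱, b ∈ Y∖X} (hᵃX − hᵇY)(kᵃX − kᵇY)`   (`X = C_u(ω)` red cluster, `Y = C_u(E∖ω)` blue cluster)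
is nonnegative for EVERY up-closed event `𝒱` and ALL monotone levels `0 ≤ hᵃ, hᵇ ≤ h`, `0 ≤ kᵃ, kᵇ ≤ k`.
This is the lane's CONJECTURE IET (Kozma–Nitzan Question-8 'coefficientwise' kernel inequality on bundles) for every chorded bundle: it contains `iet_bundle_unitThread`
(`r = 3`, gen 48) and the first open four-thread cases `Θ(ℓ₀, ℓ₁, ℓ₂, 1)` with three long threads (memo-59: open beyond `≤ 3` threads / `≤ 2` long threads), for all `r`.
PROOF: layer cake (`iet_of_indicator_levels`, `iet01_ge_count`) + the 0/1 count `bundle_unit_thread_count` = the two-type theorem on the bouquet `Θ/(u=b)`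
(`Bouquet.HBundle.x2`: canonical recursive two-stage bi-disciplined matchings, chain shift, single-cycle Lemma C) transported by `BouquetModel.bouquet_model`.
[cite: KozmaNitzan2024, Questions 8–9 (§5.5 p. 36) (context); Harris 1960; Kleitman 1966]
-/

namespace Summit.CriticalPhenomena.PercolationContinuityZ3.Theorems

open Finset Literature.Probability.Percolation

namespace Coefficientwise

variable {ι V : Type*}

open Classical in
/-- **THEOREM IET(chorded bundles): CONJECTURE IET on every bundle with a unit thread, all monotone real levels, every up-closed event.**  Module docstring.
[cite: KozmaNitzan2024, Questions 8–9 (§5.5 p. 36) (context); Harris 1960; Kleitman 1966] -/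
theorem iet_bundle_withUnitThread (ends : ι → Sym2 V) (r : ℕ) (L : ℕ → ℕ) (hL : ∀ t, t < r → 1 ≤ L t)
    (w : ℕ → ℕ → V) (e : ℕ → ℕ → ι) (u b : V)
    (hw0 : ∀ t, t < r → w t 0 = u) (hwL : ∀ t, t < r → w t (L t) = b)
    (harc : ∀ t, t < r → ∀ j, 1 ≤ j → j ≤ L t → ends (e t j) = s(w t (j - 1), w t j))
    (hwinj : ∀ t, t < r → ∀ i j, i ≤ L t → j ≤ L t → w t i = w t j → i = j)
    (hcross : ∀ t t', t < r → t' < r → t ≠ t' → ∀ i j, i ≤ L t → j ≤ L t' → w t i = w t' j → (i = 0 ∧ j = 0) ∨ (i = L t ∧ j = L t'))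
    (A : ℕ → Finset ι) (hA : ∀ t, t < r → ∀ i, i ∈ A t ↔ ∃ j, 1 ≤ j ∧ j ≤ L t ∧ e t j = i)
    (hAdisj : ∀ t t', t < r → t' < r → t ≠ t' → Disjoint (A t) (A t'))
    (E : Finset ι) (hEA : ∀ i, i ∈ E ↔ ∃ t, t < r ∧ i ∈ A t)
    (tc : ℕ) (htc : tc < r) (hunit : L tc = 1)
    (𝒱 : Finset ι → Prop) (hV : ∀ ⦃s t : Finset ι⦄, s ⊆ t → 𝒱 s → 𝒱 t)
    (h k ha hb ka kb : Set V → ℝ) (mh : Monotone h) (mk : Monotone k)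
    (mha : Monotone ha) (mhb : Monotone hb) (mka : Monotone ka) (mkb : Monotone kb)
    (ha0 : ∀ S, 0 ≤ ha S) (hah : ∀ S, ha S ≤ h S) (hb0 : ∀ S, 0 ≤ hb S) (hbh : ∀ S, hb S ≤ h S)
    (ka0 : ∀ S, 0 ≤ ka S) (kak : ∀ S, ka S ≤ k S) (kb0 : ∀ S, 0 ≤ kb S) (kbk : ∀ S, kb S ≤ k S) :
    0 ≤ (∑ ω ∈ E.powerset, if 𝒱 ω ∧ (b ∈ openCluster (ends '' (↑ω : Set ι)) u ∧ b ∉ openCluster (ends '' (↑(E \ ω) : Set ι)) u) then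
        h (openCluster (ends '' (↑ω : Set ι)) u) * k (openCluster (ends '' (↑ω : Set ι)) u) else 0)
      + ∑ ω ∈ E.powerset, if 𝒱 ω ∧ (b ∈ openCluster (ends '' (↑(E \ ω) : Set ι)) u ∧ b ∉ openCluster (ends '' (↑ω : Set ι)) u) then
        (ha (openCluster (ends '' (↑ω : Set ι)) u) - hb (openCluster (ends '' (↑(E \ ω) : Set ι)) u)) *
          (ka (openCluster (ends '' (↑ω : Set ι)) u) - kb (openCluster (ends '' (↑(E \ ω) : Set ι)) u)) else 0 := by
  set C : Finset ι → Set V := fun ω => openCluster (ends '' (↑ω : Set ι)) u with hC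
  refine iet_of_indicator_levels E (fun ω => 𝒱 ω ∧ (b ∈ C ω ∧ b ∉ C (E \ ω)))
    (fun ω => 𝒱 ω ∧ (b ∈ C (E \ ω) ∧ b ∉ C ω)) C (fun ω => C (E \ ω)) ?_
    h k ha hb ka kb mh mk mha mhb mka mkb ha0 hah hb0 hbh ka0 kak kb0 kbk
  intro h k ha hb ka kb mh mk mha mhb mka mkb h01' k01 ha01 hb01 ka01 kb01 hah hbh kak kbk
  have cnt := iet01_ge_count E (fun ω => 𝒱 ω ∧ (b ∈ C ω ∧ b ∉ C (E \ ω)))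
    (fun ω => 𝒱 ω ∧ (b ∈ C (E \ ω) ∧ b ∉ C ω)) C (fun ω => C (E \ ω)) h k ha hb ka kb h01' k01 ha01 hb01 ka01 kb01
  have ct := bundle_unit_thread_count ends r L hL w e u b hw0 hwL harc hwinj hcross A hA hAdisj E hEA tc htc hunit 𝒱 hV
    h k ha hb ka kb mha mhb mka mkb h01' k01 ha01 hb01 ka01 kb01 hah hbh kak kbk
  -- the four 0/1 sums are the four counts
  have d1 : (∑ ω ∈ E.powerset, if (𝒱 ω ∧ (b ∈ C (E \ ω) ∧ b ∉ C ω)) ∧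
        ha (C ω) = 1 ∧ kb (C (E \ ω)) = 1 ∧ hb (C (E \ ω)) = 0 ∧ ka (C ω) = 0 then (1 : ℝ) else 0) =
      (((E.powerset).filter (fun σ => 𝒱 σ ∧ (b ∈ C (E \ σ) ∧ b ∉ C σ) ∧
        (ha (C σ) = 1 ∧ hb (C (E \ σ)) = 0) ∧ (kb (C (E \ σ)) = 1 ∧ ka (C σ) = 0))).card : ℝ) := by
    rw [Finset.natCast_card_filter]
    refine Finset.sum_congr rfl fun ω _ => ?_
    by_cases hP : (𝒱 ω ∧ (b ∈ C (E \ ω) ∧ b ∉ C ω)) ∧ ha (C ω) = 1 ∧ kb (C (E \ ω)) = 1 ∧ hb (C (E \ ω)) = 0 ∧ ka (C ω) = 0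
    · rw [if_pos hP, if_pos ⟨hP.1.1, hP.1.2, ⟨hP.2.1, hP.2.2.2.1⟩, ⟨hP.2.2.1, hP.2.2.2.2⟩⟩]
    · rw [if_neg hP, if_neg (fun hQ => hP ⟨⟨hQ.1, hQ.2.1⟩, hQ.2.2.1.1, hQ.2.2.2.1, hQ.2.2.1.2, hQ.2.2.2.2⟩)]
  have d2 : (∑ ω ∈ E.powerset, if (𝒱 ω ∧ (b ∈ C (E \ ω) ∧ b ∉ C ω)) ∧
        hb (C (E \ ω)) = 1 ∧ ka (C ω) = 1 ∧ ha (C ω) = 0 ∧ kb (C (E \ ω)) = 0 then (1 : ℝ) else 0) =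
      (((E.powerset).filter (fun σ => 𝒱 σ ∧ (b ∈ C (E \ σ) ∧ b ∉ C σ) ∧
        (ka (C σ) = 1 ∧ kb (C (E \ σ)) = 0) ∧ (hb (C (E \ σ)) = 1 ∧ ha (C σ) = 0))).card : ℝ) := by
    rw [Finset.natCast_card_filter]
    refine Finset.sum_congr rfl fun ω _ => ?_
    by_cases hP : (𝒱 ω ∧ (b ∈ C (E \ ω) ∧ b ∉ C ω)) ∧ hb (C (E \ ω)) = 1 ∧ ka (C ω) = 1 ∧ ha (C ω) = 0 ∧ kb (C (E \ ω)) = 0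
    · rw [if_pos hP, if_pos ⟨hP.1.1, hP.1.2, ⟨hP.2.2.1, hP.2.2.2.2⟩, ⟨hP.2.1, hP.2.2.2.1⟩⟩]
    · rw [if_neg hP, if_neg (fun hQ => hP ⟨⟨hQ.1, hQ.2.1⟩, hQ.2.2.2.1, hQ.2.2.1.1, hQ.2.2.2.2, hQ.2.2.1.2⟩)]
  have d3 : (∑ ω ∈ E.powerset, if (𝒱 ω ∧ (b ∈ C (E \ ω) ∧ b ∉ C ω)) ∧
        ha (C ω) = 1 ∧ ka (C ω) = 1 ∧ hb (C (E \ ω)) = 0 ∧ kb (C (E \ ω)) = 0 then (1 : ℝ) else 0) =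
      (((E.powerset).filter (fun σ => 𝒱 σ ∧ (b ∈ C (E \ σ) ∧ b ∉ C σ) ∧
        (ha (C σ) = 1 ∧ ka (C σ) = 1 ∧ hb (C (E \ σ)) = 0 ∧ kb (C (E \ σ)) = 0))).card : ℝ) := by
    rw [Finset.natCast_card_filter]
    refine Finset.sum_congr rfl fun ω _ => ?_
    by_cases hP : (𝒱 ω ∧ (b ∈ C (E \ ω) ∧ b ∉ C ω)) ∧ ha (C ω) = 1 ∧ ka (C ω) = 1 ∧ hb (C (E \ ω)) = 0 ∧ kb (C (E \ ω)) = 0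
    · rw [if_pos hP, if_pos ⟨hP.1.1, hP.1.2, hP.2⟩]
    · rw [if_neg hP, if_neg (fun hQ => hP ⟨⟨hQ.1, hQ.2.1⟩, hQ.2.2⟩)]
  have s1 : (∑ ω ∈ E.powerset, if (𝒱 ω ∧ (b ∈ C ω ∧ b ∉ C (E \ ω))) ∧ h (C ω) = 1 ∧ k (C ω) = 1 then (1 : ℝ) else 0) =
      (((E.powerset).filter (fun lam => 𝒱 lam ∧ (b ∈ C lam ∧ b ∉ C (E \ lam)) ∧ h (C lam) = 1 ∧ k (C lam) = 1)).card : ℝ) := by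
    rw [Finset.natCast_card_filter]
    refine Finset.sum_congr rfl fun ω _ => ?_
    by_cases hP : (𝒱 ω ∧ (b ∈ C ω ∧ b ∉ C (E \ ω))) ∧ h (C ω) = 1 ∧ k (C ω) = 1
    · rw [if_pos hP, if_pos ⟨hP.1.1, hP.1.2, hP.2⟩]
    · rw [if_neg hP, if_neg (fun hQ => hP ⟨⟨hQ.1, hQ.2.1⟩, hQ.2.2⟩)]
  have ct' : (((E.powerset).filter (fun σ => 𝒱 σ ∧ (b ∈ C (E \ σ) ∧ b ∉ C σ) ∧
        (ha (C σ) = 1 ∧ hb (C (E \ σ)) = 0) ∧ (kb (C (E \ σ)) = 1 ∧ ka (C σ) = 0))).card : ℝ) +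
      (((E.powerset).filter (fun σ => 𝒱 σ ∧ (b ∈ C (E \ σ) ∧ b ∉ C σ) ∧
        (ka (C σ) = 1 ∧ kb (C (E \ σ)) = 0) ∧ (hb (C (E \ σ)) = 1 ∧ ha (C σ) = 0))).card : ℝ) ≤
      (((E.powerset).filter (fun lam => 𝒱 lam ∧ (b ∈ C lam ∧ b ∉ C (E \ lam)) ∧ h (C lam) = 1 ∧ k (C lam) = 1)).card : ℝ) +
      (((E.powerset).filter (fun σ => 𝒱 σ ∧ (b ∈ C (E \ σ) ∧ b ∉ C σ) ∧
        (ha (C σ) = 1 ∧ ka (C σ) = 1 ∧ hb (C (E \ σ)) = 0 ∧ kb (C (E \ σ)) = 0))).card : ℝ) := by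
    have hnat := (Nat.cast_le (α := ℝ)).mpr ct
    rw [Nat.cast_add, Nat.cast_add] at hnat
    convert hnat using 4
  refine le_trans ?_ cnt
  linarith [d1, d2, d3, s1, ct']

open Classical in
/-- **IET on `Θ(ℓ₀, ℓ₁, ℓ₂, 1)`, lane format `r = 4` with the unit thread last** (the first open case named in memo-59/61: four threads, three of them long).
[cite: KozmaNitzan2024, Questions 8–9 (§5.5 p. 36) (context); Harris 1960; Kleitman 1966] -/
theorem iet_bundle_fourThreads_unit (ends : ι → Sym2 V) (r : ℕ) (hr : r = 4) (L : ℕ → ℕ) (hL : ∀ t, t < r → 1 ≤ L t) (hunit : L 3 = 1)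
    (w : ℕ → ℕ → V) (e : ℕ → ℕ → ι) (u b : V)
    (hw0 : ∀ t, t < r → w t 0 = u) (hwL : ∀ t, t < r → w t (L t) = b)
    (harc : ∀ t, t < r → ∀ j, 1 ≤ j → j ≤ L t → ends (e t j) = s(w t (j - 1), w t j))
    (hwinj : ∀ t, t < r → ∀ i j, i ≤ L t → j ≤ L t → w t i = w t j → i = j)
    (hcross : ∀ t t', t < r → t' < r → t ≠ t' → ∀ i j, i ≤ L t → j ≤ L t' → w t i = w t' j → (i = 0 ∧ j = 0) ∨ (i = L t ∧ j = L t'))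
    (A : ℕ → Finset ι) (hA : ∀ t, t < r → ∀ i, i ∈ A t ↔ ∃ j, 1 ≤ j ∧ j ≤ L t ∧ e t j = i)
    (hAdisj : ∀ t t', t < r → t' < r → t ≠ t' → Disjoint (A t) (A t'))
    (E : Finset ι) (hEA : ∀ i, i ∈ E ↔ ∃ t, t < r ∧ i ∈ A t)
    (𝒱 : Finset ι → Prop) (hV : ∀ ⦃s t : Finset ι⦄, s ⊆ t → 𝒱 s → 𝒱 t)
    (h k ha hb ka kb : Set V → ℝ) (mh : Monotone h) (mk : Monotone k)
    (mha : Monotone ha) (mhb : Monotone hb) (mka : Monotone ka) (mkb : Monotone kb)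
    (ha0 : ∀ S, 0 ≤ ha S) (hah : ∀ S, ha S ≤ h S) (hb0 : ∀ S, 0 ≤ hb S) (hbh : ∀ S, hb S ≤ h S)
    (ka0 : ∀ S, 0 ≤ ka S) (kak : ∀ S, ka S ≤ k S) (kb0 : ∀ S, 0 ≤ kb S) (kbk : ∀ S, kb S ≤ k S) :
    0 ≤ (∑ ω ∈ E.powerset, if 𝒱 ω ∧ (b ∈ openCluster (ends '' (↑ω : Set ι)) u ∧ b ∉ openCluster (ends '' (↑(E \ ω) : Set ι)) u) then
        h (openCluster (ends '' (↑ω : Set ι)) u) * k (openCluster (ends '' (↑ω : Set ι)) u) else 0)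
      + ∑ ω ∈ E.powerset, if 𝒱 ω ∧ (b ∈ openCluster (ends '' (↑(E \ ω) : Set ι)) u ∧ b ∉ openCluster (ends '' (↑ω : Set ι)) u) then
        (ha (openCluster (ends '' (↑ω : Set ι)) u) - hb (openCluster (ends '' (↑(E \ ω) : Set ι)) u)) *
          (ka (openCluster (ends '' (↑ω : Set ι)) u) - kb (openCluster (ends '' (↑(E \ ω) : Set ι)) u)) else 0 :=
  iet_bundle_withUnitThread ends r L hL w e u b hw0 hwL harc hwinj hcross A hA hAdisj E hEA 3 (by omega) hunit
    𝒱 hV h k ha hb ka kb mh mk mha mhb mka mkb ha0 hah hb0 hbh ka0 kak kb0 kbk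

end Coefficientwise

end Summit.CriticalPhenomena.PercolationContinuityZ3.Theorems
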